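import Summits.ABC.StewartYu.ArchG3Functions
import Summits.ABC.StewartYu.PadicG3TwoFeldmanBasis
import Literature.NumberTheory.Transcendental.Waldschmidt1980Delta
import HarnessLib

/-!
# Cell abc-stewartyu, rung A1.L (crux r2 `ArchCoreRat`), parcel WP-L.A P-A4: the SUPPLY of the `Y₀`-weights — Nesterenko's level polynomials
# `Δ(2^e Y₀; ℓ₀, H)`, their sizes on a complex disc (the `W` of the growth and comparison lemmas) and the integrality and size of their
# Hasse values at the integer nodes (the `den₀`, `M₀` of the Liouville data)

`Summits/ABC/StewartYu/ArchG3Supply.lean` — cell `abc-stewartyu` (seat p5-g7; tranche plan §4′ P-A4 «Lemma 3.10»).  One definition (`scaledFeldR`,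
setup-free) and theorems; no named fact.  Archimedean twin of `PadicG3Supply.lean` (`G3Setup.Rl`, `norm_coeff_hw_Rl_mul_pow_le`,
`exists_int_lcm_pow_mul_hasse_Rl`; seat p2-g4): there the `Y₀`-weights were controlled through `p`-adic coefficient norms at the slab radius,
here through the ARCHIMEDEAN values on the disc `|z| ≤ ρ` — Nesterenko's Prop. 3.1 (2) / (3.38)–(3.39): for every Hasse order `t₀`,
`|(Hasse_{t₀} Δ(2^e·; ℓ₀, H))(z)| ≤ 2^{e t₀} · e^{H/e} · (e(1 + 2^e|z|/H))^{ℓ₀}` (no `t₀!`, no `ℓ₀!`: Fel'dman's normalisation), from the tree's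
`FeldmanDelta.norm_hasseDeriv_num_eval_le` (domination `ℂ → ℝ`) and `DirWeights.hasse_num_div_den_le`.

* `scaledFeldR ℓ H e = Δ(Y₀; ℓ, H) ∘ (2^e Y₀) ∈ ℚ[Y₀]` (print's `Δ(2^{S−s}ζ, ℓ₀, H)`, `e = S − s`), `natDegree_scaledFeldR_le`, `hasse_scaledFeldR_eval`;
* **`norm_hw_scaledFeldR_le`** — for `R i = scaledFeldR (ℓ₀ i) H e`: `‖(hw R i t₀)(z)‖ ≤ 2^{e t₀}·e^{H/e}·(e(1 + 2^e‖z‖/H))^{ℓ₀ i}` on `ℂ`, and the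
  uniform form **`norm_hw_scaledFeldR_le_of_le`** (`t₀ ≤ N`, `ℓ₀ i ≤ L₀`, `‖z‖ ≤ ρ` ⇒ `≤ 2^{eN} e^{H/e} (e(1 + 2^eρ/H))^{L₀}` — the `W` of
  `ArchG3Sizes.norm_exp_mul_archF_le_of_disc` / `norm_archF_sub_archΦ_le`);
* **`exists_int_lcm_pow_mul_hasse_scaledFeldR`** — `den₀ := ν(H)^t` clears `(Hasse_t scaledFeldR)(x)` at an integer `x`, with
  `|·| ≤ M₀` once `M₀ ≥ 2^{et} ν(H)^t e^{H/e} (e(1 + 2^e|x|/H))^ℓ` (the `hR` of `ArchG3Values.exists_int_clear_mul_archφ_zero`), and the real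
  form `abs_hasse_scaledFeldR_eval_le` (the `hW` of `ArchG3Sizes.archF_envelope_of_vanishing`).

WHAT THIS IS NOT: no weighted `ℓ₀`-sum (Lemma 3.10's `(16^{n+8.4}N)^{L₀−ℓ₀}` weights belong to print's weighted Siegel lemma, not used by design B —
the unweighted sum is `DirWeights.sum_hasse_num_div_den_mul_pow_le` if ever wanted); no parameters; no crux moves.

References: Yu. V. Nesterenko, LNM 1819 (2003), §3.1 Prop. 3.1, §3.5 (3.34), Lemma 3.10 (3.35)–(3.39); Yu. V. Nesterenko, M. Waldschmidt,
Mat. Zametki 1996, Lemma 4 (the tree's `FeldmanDeltaPolynomials`).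
-/

noncomputable section

open Finset Polynomial
open Literature.NumberTheory.Transcendental
open Literature.NumberTheory.Transcendental.FeldmanDelta (num den den_pos)
open Summit.ABC.StewartYu.FeldmanBasis (feldR natDegree_feldR_le hasseDeriv_C_mul hasseDeriv_feldR_eval
  lcm_pow_mul_hasse_feldR_eq_zeroWeight)
open scoped Nat

namespace Summit.ABC.StewartYu.ArchSupply

/-! ### The level polynomials -/

/-- **The level polynomial** `Δ(Y₀; ℓ, H) ∘ (2^e Y₀)` (print's `Δ(2^{S−s}ζ; ℓ₀, H)` read as a polynomial in `ζ`, `e = S − s`).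
[cite: Nesterenko2003, §3.5 (3.34)] -/
def scaledFeldR (ℓ H e : ℕ) : ℚ[X] := (feldR ℓ H).comp (C ((2 : ℚ) ^ e) * X)

/-- `deg (Δ(·; ℓ, H) ∘ 2^e·) ≤ ℓ`. [cite: Nesterenko2003, §3.1] -/
theorem natDegree_scaledFeldR_le (ℓ H e : ℕ) : (scaledFeldR ℓ H e).natDegree ≤ ℓ := by
  unfold scaledFeldR
  refine natDegree_comp_le.trans ?_
  rw [natDegree_C_mul (pow_ne_zero _ two_ne_zero), natDegree_X, mul_one]
  exact natDegree_feldR_le ℓ H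

/-- `(Hasse_t (Δ ∘ 2^e·))(y) = 2^{et} · (Hasse_t Δ)(2^e y)`. [folklore] -/
theorem hasse_scaledFeldR_eval (ℓ H e t : ℕ) (y : ℚ) :
    (hasseDeriv t (scaledFeldR ℓ H e)).eval y = ((2 : ℚ) ^ e) ^ t * (hasseDeriv t (feldR ℓ H)).eval ((2 : ℚ) ^ e * y) :=
  Waldschmidt1980.hasseDeriv_comp_C_mul_X_eval' _ _ _ _

/-- **The half-point relation** (for the Kummer half-step, P-A6): `(Hasse_t (Δ ∘ 2^{e+1}·))(s/2) = 2^t · (Hasse_t (Δ ∘ 2^e·))(s)` — the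
value at a half-integer of the level-`e+1` polynomial is a dyadic multiple of an integer-node value one level down.
[cite: Nesterenko2003, §4.3 (4.36)–(4.37); shape only] -/
theorem hasse_scaledFeldR_half (ℓ H e t : ℕ) (s₁ : ℚ) :
    (hasseDeriv t (scaledFeldR ℓ H (e + 1))).eval (s₁ / 2) = (2 : ℚ) ^ t * (hasseDeriv t (scaledFeldR ℓ H e)).eval s₁ := by
  rw [hasse_scaledFeldR_eval, hasse_scaledFeldR_eval, pow_succ]
  have harg : (2 : ℚ) ^ e * 2 * (s₁ / 2) = (2 : ℚ) ^ e * s₁ := by ring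
  rw [harg, mul_pow]
  ring

/-! ### Sizes on the complex disc -/

/-- `Hasse` commutes with `map`. [folklore] -/
private theorem hasseDeriv_map_rat (f : ℚ[X]) (t : ℕ) :
    (hasseDeriv t f).map (algebraMap ℚ ℂ) = hasseDeriv t (f.map (algebraMap ℚ ℂ)) := by
  ext k
  simp only [coeff_map, hasseDeriv_coeff, map_mul, map_natCast]

/-- The level polynomial read in `ℂ`: `(Δ ∘ 2^e·).map = C(den⁻¹) · (num_ℂ ∘ 2^e·)`. [folklore] -/
theorem map_scaledFeldR (ℓ H e : ℕ) :
    (scaledFeldR ℓ H e).map (algebraMap ℚ ℂ) = C (((den ℓ H : ℚ)⁻¹ : ℚ) : ℂ) * (num ℂ ℓ H).comp (C ((2 : ℂ) ^ e) * X) := by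
  unfold scaledFeldR feldR
  rw [Polynomial.map_comp, Polynomial.map_mul, Polynomial.map_C, DirWeights.map_num, Polynomial.map_mul, Polynomial.map_C,
    Polynomial.map_X, mul_comp, C_comp]
  congr 2
  simp

/-- **The `Y₀`-weight on the complex plane**: for `R i = Δ(·; ℓ₀ i, H) ∘ 2^e·` and every Hasse order `t₀`,
`‖(hw R i t₀)(z)‖ ≤ 2^{e t₀} · e^{H/e} · (e(1 + 2^e‖z‖/H))^{ℓ₀ i}` (`H ≥ 1`). [cite: Nesterenko2003, §3.1 Prop. 3.1 (2), §3.5 (3.38)–(3.39)] -/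
theorem norm_hw_scaledFeldR_le {ι : Type*} (ℓ₀ : ι → ℕ) {H : ℕ} (hH : 1 ≤ H) (e : ℕ) (i : ι) (t₀ : ℕ) (z : ℂ) :
    ‖(ArchG3Setup.hw (fun i => scaledFeldR (ℓ₀ i) H e) i t₀).eval z‖ ≤
      (2 : ℝ) ^ (e * t₀) * (Real.exp (H / Real.exp 1) * (Real.exp 1 * (1 + (2 : ℝ) ^ e * ‖z‖ / H)) ^ ℓ₀ i) := by
  have hden : (0 : ℝ) < den (ℓ₀ i) H := by exact_mod_cast den_pos (ℓ₀ i) H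
  -- the complex polynomial and its Hasse derivative at `z`
  have hpoly : ArchG3Setup.hw (fun i => scaledFeldR (ℓ₀ i) H e) i t₀ =
      C (((den (ℓ₀ i) H : ℚ)⁻¹ : ℚ) : ℂ) * hasseDeriv t₀ ((num ℂ (ℓ₀ i) H).comp (C ((2 : ℂ) ^ e) * X)) := by
    unfold ArchG3Setup.hw
    rw [hasseDeriv_map_rat, map_scaledFeldR, hasseDeriv_C_mul]
  have heval : (ArchG3Setup.hw (fun i => scaledFeldR (ℓ₀ i) H e) i t₀).eval z =
      (((den (ℓ₀ i) H : ℚ)⁻¹ : ℚ) : ℂ) * (((2 : ℂ) ^ e) ^ t₀ * (hasseDeriv t₀ (num ℂ (ℓ₀ i) H)).eval ((2 : ℂ) ^ e * z)) := by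
    rw [hpoly, eval_mul, eval_C, CW77.hasseDeriv_comp_C_mul_X_eval]
  rw [heval, norm_mul, norm_mul, norm_pow, norm_pow, Complex.norm_ofNat]
  have hnd : ‖((((den (ℓ₀ i) H : ℚ)⁻¹ : ℚ)) : ℂ)‖ = ((den (ℓ₀ i) H : ℝ))⁻¹ := by
    rw [← Complex.ofReal_ratCast, Complex.norm_real, Real.norm_eq_abs]
    push_cast
    rw [abs_inv, Nat.abs_cast]
  rw [hnd]
  -- domination and Fel'dman's bound
  have h1 := FeldmanDelta.norm_hasseDeriv_num_eval_le (ℓ₀ i) H t₀ ((2 : ℂ) ^ e * z)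
  have hy0 : (0 : ℝ) ≤ ‖(2 : ℂ) ^ e * z‖ := norm_nonneg _
  have h2 := DirWeights.hasse_num_div_den_le (ℓ₀ i) hH t₀ hy0
  have hy : ‖(2 : ℂ) ^ e * z‖ = (2 : ℝ) ^ e * ‖z‖ := by rw [norm_mul, norm_pow, Complex.norm_ofNat]
  rw [hy] at h2
  rw [div_le_iff₀ hden] at h2
  have h3 : ((den (ℓ₀ i) H : ℝ))⁻¹ * ‖(hasseDeriv t₀ (num ℂ (ℓ₀ i) H)).eval ((2 : ℂ) ^ e * z)‖ ≤
      Real.exp (H / Real.exp 1) * (Real.exp 1 * (1 + (2 : ℝ) ^ e * ‖z‖ / H)) ^ ℓ₀ i := by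
    rw [inv_mul_le_iff₀ hden]
    refine h1.trans ?_
    rw [hy]
    linarith
  rw [pow_mul]
  calc ((den (ℓ₀ i) H : ℝ))⁻¹ * (((2 : ℝ) ^ e) ^ t₀ * ‖(hasseDeriv t₀ (num ℂ (ℓ₀ i) H)).eval ((2 : ℂ) ^ e * z)‖)
      = ((2 : ℝ) ^ e) ^ t₀ * (((den (ℓ₀ i) H : ℝ))⁻¹ * ‖(hasseDeriv t₀ (num ℂ (ℓ₀ i) H)).eval ((2 : ℂ) ^ e * z)‖) := by ring
    _ ≤ ((2 : ℝ) ^ e) ^ t₀ * (Real.exp (H / Real.exp 1) * (Real.exp 1 * (1 + (2 : ℝ) ^ e * ‖z‖ / H)) ^ ℓ₀ i) :=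
        mul_le_mul_of_nonneg_left h3 (by positivity)

/-- **The uniform `W`** of the growth and comparison lemmas: for `t₀ ≤ N`, `ℓ₀ i ≤ L₀` and `‖z‖ ≤ ρ`,
`‖(hw R i t₀)(z)‖ ≤ 2^{eN} · e^{H/e} · (e(1 + 2^eρ/H))^{L₀}`. [cite: Nesterenko2003, §3.5 Lemma 3.10 (3.35), (3.38)–(3.39)] -/
theorem norm_hw_scaledFeldR_le_of_le {ι : Type*} (ℓ₀ : ι → ℕ) {H : ℕ} (hH : 1 ≤ H) (e : ℕ) {L₀ N : ℕ} {ρ : ℝ}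
    (i : ι) (hi : ℓ₀ i ≤ L₀) {t₀ : ℕ} (ht₀ : t₀ ≤ N) {z : ℂ} (hz : ‖z‖ ≤ ρ) :
    ‖(ArchG3Setup.hw (fun i => scaledFeldR (ℓ₀ i) H e) i t₀).eval z‖ ≤
      (2 : ℝ) ^ (e * N) * (Real.exp (H / Real.exp 1) * (Real.exp 1 * (1 + (2 : ℝ) ^ e * ρ / H)) ^ L₀) := by
  have hH0 : (0 : ℝ) < H := by exact_mod_cast hH
  have hρ0 : 0 ≤ ρ := (norm_nonneg _).trans hz
  have hbase1 : 1 ≤ Real.exp 1 * (1 + (2 : ℝ) ^ e * ρ / H) := by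
    have he1 : 1 ≤ Real.exp 1 := Real.one_le_exp zero_le_one
    have h1 : (1 : ℝ) ≤ 1 + (2 : ℝ) ^ e * ρ / H := le_add_of_nonneg_right (by positivity)
    nlinarith
  refine (norm_hw_scaledFeldR_le ℓ₀ hH e i t₀ z).trans ?_
  refine mul_le_mul (pow_le_pow_right₀ (by norm_num) (Nat.mul_le_mul_left e ht₀)) ?_ (by positivity) (by positivity)
  refine mul_le_mul_of_nonneg_left ?_ (by positivity)
  calc (Real.exp 1 * (1 + (2 : ℝ) ^ e * ‖z‖ / H)) ^ ℓ₀ i ≤ (Real.exp 1 * (1 + (2 : ℝ) ^ e * ρ / H)) ^ ℓ₀ i := by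
        refine pow_le_pow_left₀ (by positivity) ?_ _
        refine mul_le_mul_of_nonneg_left (add_le_add le_rfl ?_) (by positivity)
        exact div_le_div_of_nonneg_right (mul_le_mul_of_nonneg_left hz (by positivity)) hH0.le
    _ ≤ (Real.exp 1 * (1 + (2 : ℝ) ^ e * ρ / H)) ^ L₀ := pow_le_pow_right₀ hbase1 hi

/-! ### Hasse values at the integer nodes: integrality and size -/

/-- **Integrality and size at an integer node** (`den₀ = ν(H)^t`, `ν(H) = lcm(1,…,H)`): `ν(H)^t · (Hasse_t (Δ ∘ 2^e·))(x) ∈ ℤ` with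
`|·| ≤ M₀` as soon as `M₀ ≥ 2^{et} ν(H)^t e^{H/e} (e(1 + |2^e x|/H))^ℓ`. [cite: Nesterenko2003, §3.1 Prop. 3.1, §3.5 (p. 72)] -/
theorem exists_int_lcm_pow_mul_hasse_scaledFeldR (ℓ : ℕ) {H : ℕ} (hH : 1 ≤ H) (e t : ℕ) (x : ℤ) {M₀ : ℤ}
    (hM : (2 : ℝ) ^ (e * t) * ((Nat.lcmUpto H : ℝ) ^ t *
      (Real.exp (H / Real.exp 1) * (Real.exp 1 * (1 + |((2 ^ e * x : ℤ) : ℝ)| / H)) ^ ℓ)) ≤ M₀) :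
    ∃ z₀ : ℤ, (((Nat.lcmUpto H) ^ t : ℕ) : ℚ) * (hasseDeriv t (scaledFeldR ℓ H e)).eval (x : ℚ) = z₀ ∧ |z₀| ≤ M₀ := by
  set z₁ : ℤ := DirWeights.zeroWeight ℓ H t (2 ^ e * x) with hz₁def
  have hz₁ : (((Nat.lcmUpto H) ^ t : ℕ) : ℚ) * (hasseDeriv t (feldR ℓ H)).eval (((2 ^ e * x : ℤ)) : ℚ) = (z₁ : ℚ) :=
    lcm_pow_mul_hasse_feldR_eq_zeroWeight ℓ hH t _
  have hz₁le : |(z₁ : ℝ)| ≤ (Nat.lcmUpto H : ℝ) ^ t *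
      (Real.exp (H / Real.exp 1) * (Real.exp 1 * (1 + |((2 ^ e * x : ℤ) : ℝ)| / H)) ^ ℓ) :=
    DirWeights.abs_zeroWeight_le ℓ hH t _
  refine ⟨2 ^ (e * t) * z₁, ?_, ?_⟩
  · rw [hasse_scaledFeldR_eval]
    push_cast at hz₁ ⊢
    rw [← pow_mul]
    calc ((Nat.lcmUpto H : ℚ)) ^ t * ((2 : ℚ) ^ (e * t) * (hasseDeriv t (feldR ℓ H)).eval ((2 : ℚ) ^ e * (x : ℚ)))
        = (2 : ℚ) ^ (e * t) * (((Nat.lcmUpto H : ℚ)) ^ t * (hasseDeriv t (feldR ℓ H)).eval ((2 : ℚ) ^ e * (x : ℚ))) := by ring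
      _ = (2 : ℚ) ^ (e * t) * (z₁ : ℚ) := by rw [hz₁]
  · rw [abs_mul, abs_pow, abs_two]
    have h2 : (0 : ℝ) ≤ (2 : ℝ) ^ (e * t) := by positivity
    have h3 : (((2 : ℤ) ^ (e * t) * |z₁| : ℤ) : ℝ) ≤ M₀ := by
      push_cast
      exact le_trans (mul_le_mul_of_nonneg_left hz₁le h2) hM
    exact_mod_cast h3

/-- **The real size of a Hasse value at an integer node**: `|(Hasse_t (Δ ∘ 2^e·))(x)| ≤ 2^{et} e^{H/e} (e(1 + 2^e|x|/H))^ℓ`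
(the `hW` of the value envelope). [cite: Nesterenko2003, §3.1 Prop. 3.1 (2)] -/
theorem abs_hasse_scaledFeldR_eval_le {ι : Type*} (ℓ₀ : ι → ℕ) {H : ℕ} (hH : 1 ≤ H) (e : ℕ) (i : ι) (t₀ : ℕ) (x : ℤ) :
    |(((hasseDeriv t₀ (scaledFeldR (ℓ₀ i) H e)).eval (x : ℚ) : ℚ) : ℝ)| ≤
      (2 : ℝ) ^ (e * t₀) * (Real.exp (H / Real.exp 1) * (Real.exp 1 * (1 + (2 : ℝ) ^ e * |(x : ℝ)| / H)) ^ ℓ₀ i) := by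
  have h := norm_hw_scaledFeldR_le ℓ₀ hH e i t₀ (x : ℂ)
  rw [ArchG3Setup.hw_eval_intCast, ← Complex.ofReal_ratCast, Complex.norm_real, Real.norm_eq_abs, Complex.norm_intCast] at h
  exact h

/-- The uniform real size at the integer nodes `|x| ≤ Xb` for `t₀ ≤ N`, `ℓ₀ i ≤ L₀`:
`|(Hasse_{t₀} R i)(x)| ≤ 2^{eN} e^{H/e} (e(1 + 2^e Xb/H))^{L₀}`. [cite: Nesterenko2003, §3.5 Lemma 3.10] -/
theorem abs_hasse_scaledFeldR_eval_le_of_le {ι : Type*} (ℓ₀ : ι → ℕ) {H : ℕ} (hH : 1 ≤ H) (e : ℕ) {L₀ N : ℕ} {Xb : ℝ}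
    (i : ι) (hi : ℓ₀ i ≤ L₀) {t₀ : ℕ} (ht₀ : t₀ ≤ N) {x : ℤ} (hx : |(x : ℝ)| ≤ Xb) :
    |(((hasseDeriv t₀ (scaledFeldR (ℓ₀ i) H e)).eval (x : ℚ) : ℚ) : ℝ)| ≤
      (2 : ℝ) ^ (e * N) * (Real.exp (H / Real.exp 1) * (Real.exp 1 * (1 + (2 : ℝ) ^ e * Xb / H)) ^ L₀) := by
  have hz : ‖((x : ℤ) : ℂ)‖ ≤ Xb := by rw [Complex.norm_intCast]; exact hx
  have h := norm_hw_scaledFeldR_le_of_le ℓ₀ hH e i hi ht₀ hz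
  rw [ArchG3Setup.hw_eval_intCast, ← Complex.ofReal_ratCast, Complex.norm_real, Real.norm_eq_abs] at h
  exact h

end Summit.ABC.StewartYu.ArchSupply

end
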